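import Literature.Geometry.Kaehler.ComplexTorusAbelianSurfacesNoncommutativeProductHodgeGroup
import Literature.Geometry.Kaehler.ComplexTorusMaximalRealMultiplicationHodgeLieAlgebraDimension
import Literature.Geometry.Kaehler.ComplexTorusHodgeGeneralTimesSmallFactorIntrinsic
import Literature.Geometry.Kaehler.ComplexTorusSimpleAbelianThreefoldFourCases
import Literature.Geometry.Kaehler.ComplexTorusAbelianThreefoldStablyNondegenerate
import Literature.Geometry.Kaehler.ComplexTorusAbelianSurfaceStablyNondegenerate
import Literature.Geometry.Kaehler.ComplexTorusEndomorphismFieldEigenspaces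
import Literature.Geometry.Kaehler.ComplexTorusHodgeGroupLieAlgebraAlgebraic
import Literature.Geometry.Kaehler.ComplexTorusStablyNondegenerateIffNoTypeIIIAndHodgeEqLefschetz
import HarnessLib

/-!
# Moonen–Zarhin 1999 Thm. (0.2) (4) for `X = T × S`, `T` a SIMPLE complex abelian threefold and `S` a SIMPLE complex abelian
# surface: `Hg(T × S) = Hg(T) × Hg(S)`, condition (D) — `ℬ•(Xⁿ) = 𝒟•(Xⁿ)` for all `n` — and `Hg(X) = Sp_D(V,φ)`, in every case
# where `T` is of Albert type I, or `T` is of CM type and `S` is not, or `End⁰(T) = ℚ` or `End⁰(S) = ℚ`; and the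
# `𝔰𝔩₂`-planes of an abelian variety with maximal real multiplication in any dimension

Layer `Literature/Geometry/Kaehler`, namespace `Literature.Geometry.Kaehler.ComplexTorus`; lane `lit-hodgefound` (Track 2
foundations library), Layer A4 (known cases of `ℬ = 𝒟`); prover seat `lit-hodgefound-p17`, generation 55, self-proposed row
g55-#3 — the Poincaré shape `(3,2)` with BOTH parts simple, sequel of ✔ g55-#1 (all simple factors of dimension `≤ 2`) and
g55-#2 (`X ∼ Y × E`, `Y` a non-simple fourfold).  THEOREMS ONLY (no definition, no instance, no notation, no named fact;
D-0026 net debt `0`).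

## Source, VERBATIM (held `paper:arxiv-math_9901113`; locators are page ∕ line of the materialisation)

B. J. J. Moonen, Yu. G. Zarhin [MoonenZarhin1999LowDim], *Hodge classes on abelian varieties of low dimension*, Math. Ann.
**315** (1999) 711–733.  Thm. (0.2) (4) (p0002 L1–L8): «Suppose we are not in one of the cases (e), (f) or (g). Decompose `X`,
up to isogeny, as a product of elementary abelian varieties, say `X ∼ Y₁^{m₁} × ⋯ × Y_r^{m_r}`. Then `Hg(X) = Hg(Y₁^{m₁}) × ⋯
Hg(Y_r^{m_r})`. … In particular, if `X` has no simple factor of dimension 4 then `Hg(X) = Sp_D(V,φ)` and `ℬ•(Xⁿ) = 𝒟•(Xⁿ)`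
for every `n ≥ 1`.»  For `X ∼ T × S` (a simple threefold and a simple surface: neither (e), (f), (g) nor a simple factor
of dimension `4`) the proof runs through §5 by `(d₁,d₂) = (dim of the part without factors of Type 4, dim of the part all of
whose factors are of Type 4)`: (5.6) (p0009 L122–L130) «Suppose `(d₁,d₂) = (5,0)` … If `X` does not contain an elliptic curve
then all its simple factors satisfy condition (D) in (3.2) and we conclude using Theorem (3.3)» [Hazama: «(1) Suppose `X₁` and
`X₂` contain no factors of Type 4. Then `X₁ × X₂` again satisfies (D), and either `Hom(X₁, X₂) ≠ 0` or `Hg(X₁ × X₂) = Hg(X₁) ×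
Hg(X₂)`», p0006 L69–L74]; (5.7) (p0009 L132–L134) «Suppose `(d₁,d₂) = (4,1)` or `(d₁,d₂) = (3,2)`. Then `X₂` is of CM-type and
Theorem (3.3) gives `Hg(X) = Hg(X₁) × Hg(X₂)`» [«(2) Suppose `X₁` has no factors of Type 4 and `X₂` is of CM-type. Then `X₁ × X₂`
again satisfies (D) and `Hg(X₁ × X₂) = Hg(X₁) × Hg(X₂)`», p0006 L76–L78]; (5.8) (p0010 L3–L11) «Suppose `(d₁,d₂) = (2,3)`. If
`X₁` is simple then Lemma (3.5) gives `Hg(X) = Hg(X₁) × Hg(X₂)`»; (5.10) (p0010 L18–L45) «`X ∼ Y₁ × Y₂` where `Y₁` is a simple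
abelian surface and `Y₂` is a simple abelian threefold. … If `Y₂` is not of CM-type then Lemma (3.6) readily gives `Hg(X) =
Hg(Y₁) × Hg(Y₂)`. If `Y₂` is of CM-type then … Looking at Galois groups we obtain a contradiction.»; §2 (2.3) `g = 3` (p0005
L83–L106: «There are four cases. Type I(1) … `Hg(X) = Sp(V,φ)` … Type I(3) … `Hg(X) = Res_{F/ℚ} Sp_F(V,ψ)` … Type IV(1,1) …
Type IV(3,1) …»); §3 (3.1) (p0006 L25–L65); Lemma (3.3) proof (p0006 L94–L104: «`𝔥𝔤(X)_ℂ` acts on each of the summands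
`U_j^d` through `𝔰𝔩(U_j^d)`»).

* B. B. Gordon [Gordon1997], *A survey of the Hodge conjecture for abelian varieties*, §2.16 (Goursat), Thm. 6.3 (sketch:
  «`Hg(A,ℂ) ≃ ∏_{σ ∈ Hom(K,ℂ)} Sp(U_σ, ψ_σ)`»), Thm. 7.5, 7.6.1–7.6.2; [Gordon1999HodgeAVSurvey] the same survey, Thm. 7.5 (1) ⟺ (2).
* J. S. Milne [Milne1999LefschetzClasses], Duke Math. J. **96** (1999), §2 («Simple abelian variety of type I»: `(V(A), φ) =
  (V₁, φ₁) ⊕ ⋯ ⊕ (V_t, φ_t)`, Prop. 2.1) and §4 Prop. 4.8.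
* F. Hazama [Hazama1983], J. Fac. Sci. Univ. Tokyo **31** (1984), Thm. (3.2), as quoted by Moonen–Zarhin.
* H. Lange [Lange2023AbelianVarietiesComplex], *Abelian Varieties over the Complex Numbers* (2023), §2.6.1 Proposition (Albert's
  table), §2.6.2 Lemma 2.6.4, §1.1.2 Cor. 1.1.16.

## The argument (Moonen–Zarhin's case map, run with the tree's instruments)

`T` a simple polarised threefold is of type I(1) (`End⁰(T) = ℚ`, `Hg = Sp₆`, `dim 21`), I(3) (totally real cubic centre,
`dim Hg = 9`), IV(1,1) or IV(3,1) = CM (the tree's `IsSimple.four_cases_of_finrank_eq_three`); `S` a simple polarised surface has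
`End⁰(S) = ℚ` (`Hg = Sp₄`), or non-commutative `Hg(S)` with `End⁰(S) ≠ ℚ` (types I(2), II(1): its `𝔤` is read on `𝔰𝔩₂`-planes,
the tree's `IsSimple.exists_sl2StablePlanes_of_not_hodgeGroup_comm_of_endAlgRat_ne_bot_of_finrank_eq_two`), or commutative
`Hg(S)` (CM).  (A) `End⁰(T) = ℚ`: `T` is Hodge-general and splits off every smaller abelian variety (the tree's
`…_of_finrank_eq_three_of_endAlgRat_eq_bot_of_finrank_eq_two`).  (B) `End⁰(S) = ℚ`, `End⁰(T) ≠ ℚ`: `dim Hg(T) ∈ {3, 9} < 10 =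
dim Sp₄`, so the Hodge-general `S` splits off `T` (the tree's `…_of_endAlgRat_eq_bot_of_zdim_lt`).  (C) `T` of type I(3), `S`
of type I(2) ∕ II(1): BOTH Hodge Lie algebras are read on `𝔰𝔩₂`-planes — for `T` the three eigenplanes `V_σ` of the cubic
field (§1: every abelian variety with real multiplication by a totally real field of degree `g = dim` has them, «`Hg(X) =
Res_{F/ℚ} Sp_F(V,ψ)`», over `ℂ` `SL₂^g`) — and two simple non-isogenous such varieties have split Hodge group (the tree's
g52-#6 `IsSimple.hodgeGroupC_prod_eq_blockDiagProd_of_stablePlanes_of_not_isIsogenous`: Hazama's (3.3)(1) mechanism, the proof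
of Lemma (3.3)).  (D') `T` of type I × `S` CM, and `T` CM × `S` of type I(2) ∕ II(1): a simple factor with totally real centre
has perfect `Hg(ℂ)`, a CM factor has commutative `Hg`, perfect × commutative splits (Thm. (3.3)(2), the tree's
`ComplexTorusSimpleTotallyRealCenterTimesCM`).  In every split case (D) transfers from `T` and `S` ((3.1); every threefold and
every surface satisfies (D)) and `Hg = Sp_D` follows by Gordon's Thm. 7.5 (A4-103).

NOT COVERED HERE (the hypothesis `h` of §3 excludes exactly these): `T` of type IV(1,1) × `S` of type I(2) ∕ II(1) ((5.8) via
Lemma (3.5)), `T` of type IV(1,1) × `S` CM ((5.10) via Lemma (3.6)–(3.7)), `T` CM × `S` CM ((5.10), the Galois-group argument).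
-- TODO(general form): these three sub-cases of Thm. (0.2) (4) for `X ∼ T × S`.

## What is proved

* §1 **`IsRiemannForm.exists_sl2StablePlanes_of_finrank_eq`** — the `𝔰𝔩₂`-PLANES OF MAXIMAL REAL MULTIPLICATION in any
  dimension: for a polarised abelian variety `X` of dimension `g` with `End⁰(X) = f(K)`, `K` totally real of degree `g`, the
  eigenplanes `V_σ` (`σ : K → ℂ`) are `𝔤`-stable planes with traceless, jointly faithful `𝔤`-action and `dim_ℂ 𝔤 = 3g`; the
  threefold front-end **`IsSimple.exists_sl2StablePlanes_of_isTotallyReal_of_endAlgRat_ne_bot_of_finrank_eq_three`** (type I(3)).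
* §2 `T × S` splittings: **`IsSimple.hodgeGroupC_prod_eq_blockDiagProd_of_isTotallyReal_of_not_hodgeGroup_comm_of_finrank_eq_three_two`**
  (I(3) × I(2)∕II(1)), and the (D)-transfers for the four covered classes.
* §3 the dispatch **`IsSimple.forall_divisorClasses_powPeriod_prod_eq_hodgeClasses_of_finrank_eq_three_two`** (`T × S` satisfies
  (D) whenever: `T` has totally real centre, or `End⁰(S) = ℚ`, or `T` is of CM type and `S` is not), its isogeny form and
  «`Hg(X) = Sp_D(V,φ)`».
-/

noncomputable section

open Module Matrix Complex Function NumberField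

namespace Literature.Geometry.Kaehler

namespace ComplexTorus

open Literature.NumberTheory.Automorphic (lieAlgebraGL)

/-! ### §0 Helpers (file-local) -/

section Helpers

variable {ι : Type*} [Fintype ι] [DecidableEq ι] {E : Type*} [NormedAddCommGroup E] [NormedSpace ℂ E]
  (Φ : (ι → ℝ) ≃L[ℝ] E)

/-- `dim_ℂ Lie Hg(X)(ℂ) = dim_ℂ 𝔤` (bridge between the LAG tangent algebra and `hodgeGroupComplexLie`). [cite: Springer1998, 4.4.5–4.4.7] -/
private theorem finrank_lieAlgebraGL_eq_finrank_hodgeGroupComplexLie₅₇ :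
    finrank ℂ (lieAlgebraGL ((hodgeGroupC Φ).map Matrix.SpecialLinearGroup.toGL)) = finrank ℂ (hodgeGroupComplexLie Φ) := by
  rw [finrank_hodgeGroupComplexLie_eq_zdim, (isZConnected_map_toGL_hodgeGroupC Φ).finrank_lieAlgebraGL_eq.2]

omit [DecidableEq ι] in
/-- A torus of positive dimension has a non-empty period index. [folklore] -/
private theorem nonempty_of_finrank_pos₅₇ [FiniteDimensional ℂ E] (Ψ : (ι → ℝ) ≃L[ℝ] E) (h : 0 < finrank ℂ E) :
    Nonempty ι :=
  Fintype.card_pos_iff.1 (by rw [card_eq_two_mul_finrank Ψ]; omega)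

end Helpers

/-! ## §1 The `𝔰𝔩₂`-planes of maximal real multiplication, any dimension; the threefold front-end (type I(3)) -/

section MaximalRealMultiplication

variable {ι : Type} [Fintype ι] [DecidableEq ι] {E : Type} [NormedAddCommGroup E] [NormedSpace ℂ E]
  [FiniteDimensional ℂ E] {Φ : (ι → ℝ) ≃L[ℝ] E} {η : E [⋀^Fin 2]→L[ℝ] ℝ} {K : Type*} [Field K] [NumberField K]
  [IsTotallyReal K]

/-- **MAXIMAL REAL MULTIPLICATION: THE EIGENPLANES `V_σ` ARE `𝔰𝔩₂`-PLANES FOR `𝔤`, IN ANY DIMENSION.**  For a polarised complex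
abelian variety of dimension `g` whose endomorphism algebra is `f(K)`, `K` a totally real number field of degree `g`, the `g`
eigenplanes `V_σ = ⋂_y ker(f(y) − σ(y))` (`σ : K → ℂ`) are `𝔤 = Lie Hg(X)(ℂ)`-stable planes on which `𝔤` acts tracelessly
(`𝔤 ⊆ 𝔩𝔣_ℂ ⊆ ∏_σ 𝔰𝔭(V_σ)`) and jointly faithfully (`V_ℂ = ⊕_σ V_σ`), and `dim_ℂ 𝔤 = 3g` («Type I(3) … `Hg(X) = Res_{F/ℚ}
Sp_F(V,ψ)`»; «`Hg(A,ℂ) ≃ ∏_{σ ∈ Hom(K,ℂ)} Sp(U_σ, ψ_σ)`»; the surface case `g = 2` is the tree's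
`IsRiemannForm.exists_sl2StablePlanes_of_finrank_eq_two`).
[cite: MoonenZarhin1999LowDim, §2 (2.3) `g = 3` («Type I(3)», p0005 L88–L92), (2.2) («Type I(2)») and §3 proof of (3.3) (p0006 L94–L104)]
[cite: Gordon1997, Thm. 6.3 (sketch)] [cite: Milne1999LefschetzClasses, §2 Prop. 2.1 and «Simple abelian variety of type I»] -/
theorem IsRiemannForm.exists_sl2StablePlanes_of_finrank_eq (hη : IsRiemannForm Φ η) (hK : finrank ℚ K = finrank ℂ E)
    (f : K →ₐ[ℚ] Matrix ι ι ℚ) (hfE : f.range = endAlgRat Φ) :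
    ∃ (U : (K →+* ℂ) → Submodule ℂ (ι → ℂ))
      (hU : ∀ a, ∀ Z ∈ lieAlgebraGL ((hodgeGroupC Φ).map Matrix.SpecialLinearGroup.toGL), ∀ u ∈ U a, Matrix.toLin' Z u ∈ U a),
      (∀ a, finrank ℂ (U a) = 2) ∧
      (∀ a Z (hZ : Z ∈ lieAlgebraGL ((hodgeGroupC Φ).map Matrix.SpecialLinearGroup.toGL)),
        LinearMap.trace ℂ _ ((Matrix.toLin' Z).restrict (hU a Z hZ)) = 0) ∧
      (∀ Z ∈ lieAlgebraGL ((hodgeGroupC Φ).map Matrix.SpecialLinearGroup.toGL),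
        (∀ a, ∀ u ∈ U a, Matrix.toLin' Z u = 0) → Z = 0) ∧
      finrank ℂ (lieAlgebraGL ((hodgeGroupC Φ).map Matrix.SpecialLinearGroup.toGL)) = 3 * Fintype.card (K →+* ℂ) := by
  classical
  haveI : Nonempty ι := nonempty_of_finrank_pos₅₇ Φ (by rw [← hK]; exact finrank_pos)
  obtain ⟨G, hGη⟩ := hη.exists_ratMatrix_latticeGram
  have hfE' : ∀ y, f y ∈ endAlgRat Φ := fun y ↦ by rw [← hfE]; exact AlgHom.mem_range_self f y
  have hGu : IsUnit G.det := isUnit_det_of_map_ratCast hGη hη.isUnit_det_latticeGram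
  have hGt : Gᵀ = -G := transpose_eq_neg_of_map_ratCast Φ hGη
  have hRos : ∀ A ∈ endAlgRat Φ, rosati G A = A := fun A hA ↦ rosati_eq_self_of_range_eq Φ f hfE hη.1 hη.2.2 hGη hA
  have hsym : ∀ a : K, (f a)ᵀ * G = G * f a := forall_transpose_mul_eq_of_forall_rosati_eq f hfE' hGu hRos
  have hLf : ∀ Z ∈ lieAlgebraGL ((hodgeGroupC Φ).map Matrix.SpecialLinearGroup.toGL), Z ∈ lefschetzLieC Φ G := fun Z hZ ↦
    hη.hodgeGroupLieC_subset_lefschetzLieC hGη ((mem_hodgeGroupLieC_iff_mem_lieAlgebraGL Φ).2 hZ)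
  set U : (K →+* ℂ) → Submodule ℂ (ι → ℂ) := fun σ ↦
    ⨅ y : K, Module.End.eigenspace (Matrix.toLin' ((f y).map (algebraMap ℚ ℂ))) (σ y) with hUdef
  have hU : ∀ a, ∀ Z ∈ lieAlgebraGL ((hodgeGroupC Φ).map Matrix.SpecialLinearGroup.toGL), ∀ u ∈ U a,
      Matrix.toLin' Z u ∈ U a := fun σ Z hZ ↦
    toLin'_apply_mem_iInf_eigenspace_algHom_of_mem_lefschetzLieC f hfE' σ (hLf Z hZ)
  refine ⟨U, hU, fun σ ↦ finrank_iInf_eigenspace_eq_two_of_finrank_eq f Φ hK σ, fun σ Z hZ ↦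
    forall_trace_restrict_eq_zero_of_mem_lefschetzLieC' f hGu.ne_zero hGt hsym σ (hLf Z hZ) (hU σ Z hZ), fun Z _ h0 ↦ ?_, ?_⟩
  · -- `V_ℂ = ⊕_σ V_σ`: a matrix killing every eigenplane is zero
    refine Matrix.toLin'.injective (LinearMap.ext fun v ↦ ?_)
    have hv : v ∈ ⨆ σ : K →+* ℂ, U σ := by
      rw [hUdef, iSup_iInf_eigenspace_toLin'_map_eq_top f]; exact Submodule.mem_top
    rw [map_zero, LinearMap.zero_apply]
    exact Submodule.iSup_induction U (motive := fun w ↦ Matrix.toLin' Z w = 0) hv (fun σ u hu ↦ h0 σ u hu) (map_zero _)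
      (fun x y hx hy ↦ by rw [map_add, hx, hy, add_zero])
  · rw [finrank_lieAlgebraGL_eq_finrank_hodgeGroupComplexLie₅₇, hη.finrank_hodgeGroupComplexLie_eq_three_mul_of_finrank_eq hK f hfE,
      NumberField.Embeddings.card, hK]

end MaximalRealMultiplication

section ThreefoldTypeOneThree

variable {κ : Type} [Fintype κ] [DecidableEq κ] [Nonempty κ] {E : Type} [NormedAddCommGroup E] [NormedSpace ℂ E]
  [FiniteDimensional ℂ E] {Ψ : (κ → ℝ) ≃L[ℝ] E} {η : E [⋀^Fin 2]→L[ℝ] ℝ}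

/-- **TYPE I(3): A SIMPLE ABELIAN THREEFOLD WITH TOTALLY REAL CENTRE AND `End⁰ ≠ ℚ` HAS ITS `𝔤` READ ON THREE `𝔰𝔩₂`-PLANES**
(`End⁰(T) = F` a totally real cubic field — `e ∈ {1, 3}` and `e = 1` is `End⁰ = ℚ` —, the eigenplanes `V_σ`, `σ : F → ℂ`;
«`Hg(X) = Res_{F/ℚ} Sp_F(V,ψ)`», `dim 9 = 3 · 3`). [cite: MoonenZarhin1999LowDim, §2 (2.3) `g = 3`, Type I(3) (p0005 L88–L92) and §3 proof of (3.3) (p0006 L94–L104)]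
[cite: Lange2023AbelianVarietiesComplex, §2.6.1 Proposition (`e ∣ g`)] -/
theorem IsSimple.exists_sl2StablePlanes_of_isTotallyReal_of_endAlgRat_ne_bot_of_finrank_eq_three (hT : IsSimple Ψ)
    [IsTotallyReal (centerField Ψ hT)] (hη : IsRiemannForm Ψ η) (h3 : finrank ℂ E = 3) (hE : endAlgRat Ψ ≠ ⊥) :
    ∃ (U : (centerField Ψ hT →+* ℂ) → Submodule ℂ (κ → ℂ))
      (hU : ∀ a, ∀ Z ∈ lieAlgebraGL ((hodgeGroupC Ψ).map Matrix.SpecialLinearGroup.toGL), ∀ u ∈ U a, Matrix.toLin' Z u ∈ U a),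
      (∀ a, finrank ℂ (U a) = 2) ∧
      (∀ a Z (hZ : Z ∈ lieAlgebraGL ((hodgeGroupC Ψ).map Matrix.SpecialLinearGroup.toGL)),
        LinearMap.trace ℂ _ ((Matrix.toLin' Z).restrict (hU a Z hZ)) = 0) ∧
      (∀ Z ∈ lieAlgebraGL ((hodgeGroupC Ψ).map Matrix.SpecialLinearGroup.toGL),
        (∀ a, ∀ u ∈ U a, Matrix.toLin' Z u = 0) → Z = 0) ∧
      finrank ℂ (lieAlgebraGL ((hodgeGroupC Ψ).map Matrix.SpecialLinearGroup.toGL)) =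
        3 * Fintype.card (centerField Ψ hT →+* ℂ) := by
  have he : finrank ℚ (centerField Ψ hT) = 3 := by
    rcases hT.finrank_centerField_eq_one_or_eq_three_of_isTotallyReal h3 with h1 | h3'
    · exact absurd ((hT.finrank_centerField_eq_one_iff_endAlgRat_eq_bot_of_finrank_eq_three hη h3).1 h1) hE
    · exact h3'
  exact hη.exists_sl2StablePlanes_of_finrank_eq (he.trans h3.symm) (centerField.valAlgHom Ψ hT)
    (hT.range_valAlgHom_eq_endAlgRat_of_finrank_eq_three h3)

end ThreefoldTypeOneThree

/-! ## §2 `T × S`: the splittings and the (D)-transfers for the covered classes -/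

section ThreefoldTimesSurface

variable {κ₁ κ₂ : Type} [Fintype κ₁] [DecidableEq κ₁] [Nonempty κ₁] [Fintype κ₂] [DecidableEq κ₂] [Nonempty κ₂]
  {E₁ E₂ : Type} [NormedAddCommGroup E₁] [NormedSpace ℂ E₁] [FiniteDimensional ℂ E₁] [NormedAddCommGroup E₂]
  [NormedSpace ℂ E₂] [FiniteDimensional ℂ E₂] {Ψ₁ : (κ₁ → ℝ) ≃L[ℝ] E₁} {Ψ₂ : (κ₂ → ℝ) ≃L[ℝ] E₂}
  {η₁ : E₁ [⋀^Fin 2]→L[ℝ] ℝ} {η₂ : E₂ [⋀^Fin 2]→L[ℝ] ℝ}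

/-- **HAZAMA'S THM. (3.3)(1) FOR `T` OF TYPE I(3) AND `S` OF TYPE I(2) ∕ II(1): `Hg(T × S)(ℂ) = Hg(T)(ℂ) × Hg(S)(ℂ)`** — `T` a
simple polarised threefold with totally real centre and `End⁰(T) ≠ ℚ`, `S` a simple polarised surface with non-commutative
Hodge group and `End⁰(S) ≠ ℚ`: both Hodge Lie algebras are read on `𝔰𝔩₂`-planes (§1; the tree's surface planes), `T ≁ S`, so
the product splits («either `Hom(X₁,X₂) ≠ 0` or `Hg(X₁ × X₂) = Hg(X₁) × Hg(X₂)`»; (5.6) «we conclude using Theorem (3.3)»).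
[cite: MoonenZarhin1999LowDim, §3 Thm. (3.3)(1) (p0006 L69–L74), §5 (5.6) (p0009 L122–L130), §2 (2.2)–(2.3)] [cite: Hazama1983, Thm. (3.2)(1)] -/
theorem IsSimple.hodgeGroupC_prod_eq_blockDiagProd_of_isTotallyReal_of_not_hodgeGroup_comm_of_finrank_eq_three_two
    (hT : IsSimple Ψ₁) (hS : IsSimple Ψ₂) [IsTotallyReal (centerField Ψ₁ hT)] (hη₁ : IsRiemannForm Ψ₁ η₁)
    (hη₂ : IsRiemannForm Ψ₂ η₂) (h3 : finrank ℂ E₁ = 3) (h2 : finrank ℂ E₂ = 2) (hE₁ : endAlgRat Ψ₁ ≠ ⊥)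
    (hnc₂ : ¬ ∀ M ∈ hodgeGroup Ψ₂, ∀ N ∈ hodgeGroup Ψ₂, M * N = N * M) (hE₂ : endAlgRat Ψ₂ ≠ ⊥) :
    hodgeGroupC (prodPeriod Ψ₁ Ψ₂) = blockDiagProd (hodgeGroupC Ψ₁) (hodgeGroupC Ψ₂) := by
  classical
  obtain ⟨U₁, hU₁, h2U₁, htr₁, hinj₁, hdim₁⟩ :=
    hT.exists_sl2StablePlanes_of_isTotallyReal_of_endAlgRat_ne_bot_of_finrank_eq_three hη₁ h3 hE₁
  obtain ⟨n₂, U₂, hU₂, h2U₂, htr₂, hinj₂, hdim₂⟩ :=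
    hS.exists_sl2StablePlanes_of_not_hodgeGroup_comm_of_endAlgRat_ne_bot_of_finrank_eq_two hη₂ h2 hnc₂ hE₂
  have hne : ¬ IsIsogenous Ψ₂ Ψ₁ := fun h ↦ by
    have hc := h.card_eq
    rw [card_eq_two_mul_finrank Ψ₂, card_eq_two_mul_finrank Ψ₁, h2, h3] at hc
    omega
  exact hT.hodgeGroupC_prod_eq_blockDiagProd_of_stablePlanes_of_not_isIsogenous hS hη₁ hη₂ hne U₁ U₂ hU₁ hU₂ h2U₁ h2U₂ htr₁
    htr₂ hinj₁ hinj₂ hdim₁ (by rw [hdim₂, Fintype.card_fin])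

/-- (D)-transfer, **`T` of type I(3) × `S` of type I(2) ∕ II(1)**: `T × S` satisfies condition (D) («Then `X₁ × X₂` again
satisfies (D)»). [cite: MoonenZarhin1999LowDim, §3 Thm. (3.3)(1) (p0006 L69–L74), §5 (5.6) (p0009 L122–L130) and Thm. (0.2) (4) (p0002 L5–L8)]
[cite: Gordon1999HodgeAVSurvey, Thm. 7.5 and 7.6.2] -/
theorem IsSimple.forall_divisorClasses_powPeriod_prod_eq_hodgeClasses_of_isTotallyReal_of_not_hodgeGroup_comm_of_finrank_eq_three_two
    (hT : IsSimple Ψ₁) (hS : IsSimple Ψ₂) [IsTotallyReal (centerField Ψ₁ hT)] (hη₁ : IsRiemannForm Ψ₁ η₁)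
    (hη₂ : IsRiemannForm Ψ₂ η₂) (h3 : finrank ℂ E₁ = 3) (h2 : finrank ℂ E₂ = 2) (hE₁ : endAlgRat Ψ₁ ≠ ⊥)
    (hnc₂ : ¬ ∀ M ∈ hodgeGroup Ψ₂, ∀ N ∈ hodgeGroup Ψ₂, M * N = N * M) (hE₂ : endAlgRat Ψ₂ ≠ ⊥) :
    ∀ k p, divisorClasses (powPeriod (prodPeriod Ψ₁ Ψ₂) k) p = hodgeClasses (powPeriod (prodPeriod Ψ₁ Ψ₂) k) p :=
  forall_divisorClasses_powPeriod_prod_eq_hodgeClasses_of_hodgeGroupC_prod_eq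
    (hT.hodgeGroupC_prod_eq_blockDiagProd_of_isTotallyReal_of_not_hodgeGroup_comm_of_finrank_eq_three_two hS hη₁ hη₂ h3 h2 hE₁
      hnc₂ hE₂)
    (hη₁.forall_divisorClasses_powPeriod_eq_hodgeClasses_of_finrank_eq_three h3)
    (IsAbelianVariety.forall_divisorClasses_powPeriod_eq_hodgeClasses_of_finrank_eq_two ⟨η₂, hη₂⟩ h2)

/-- **(5.6) ∕ (5.7) FOR `T` OF TYPE I (totally real centre: I(1) or I(3)) AND ANY SIMPLE SURFACE `S`: `T × S` satisfies (D)** —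
`S` of CM type: Thm. (3.3)(2), perfect × commutative; `End⁰(S) = ℚ` or `End⁰(T) = ℚ`: the Hodge-general factor splits off the
other (`dim Hg(T) ≤ 21`, `dim Hg(S) < 10` resp. `dim Hg(T) ∈ {3,9} < 10`); `S` of type I(2) ∕ II(1) and `T` of type I(3):
Thm. (3.3)(1) by `𝔰𝔩₂`-planes. [cite: MoonenZarhin1999LowDim, §5 (5.6)–(5.7) (p0009 L122–L134), §3 Thm. (3.3) (p0006 L69–L78), Thm. (0.2) (4)]
[cite: Gordon1999HodgeAVSurvey, Thm. 7.5 and 7.6.2] -/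
theorem IsSimple.forall_divisorClasses_powPeriod_prod_eq_hodgeClasses_of_isTotallyReal_of_finrank_eq_three_two
    (hT : IsSimple Ψ₁) (hS : IsSimple Ψ₂) [IsTotallyReal (centerField Ψ₁ hT)] (hη₁ : IsRiemannForm Ψ₁ η₁)
    (hη₂ : IsRiemannForm Ψ₂ η₂) (h3 : finrank ℂ E₁ = 3) (h2 : finrank ℂ E₂ = 2) :
    ∀ k p, divisorClasses (powPeriod (prodPeriod Ψ₁ Ψ₂) k) p = hodgeClasses (powPeriod (prodPeriod Ψ₁ Ψ₂) k) p := by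
  have hAT : IsAbelianVariety Ψ₁ := ⟨η₁, hη₁⟩
  have hAS : IsAbelianVariety Ψ₂ := ⟨η₂, hη₂⟩
  have hSNT := hη₁.forall_divisorClasses_powPeriod_eq_hodgeClasses_of_finrank_eq_three h3
  have hSNS := hAS.forall_divisorClasses_powPeriod_eq_hodgeClasses_of_finrank_eq_two h2
  by_cases hE₁ : endAlgRat Ψ₁ = ⊥
  · exact hAT.forall_divisorClasses_powPeriod_prod_eq_hodgeClasses_of_finrank_eq_three_of_endAlgRat_eq_bot_of_finrank_eq_two
      Ψ₂ h3 hE₁ hAS h2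
  by_cases hc₂ : ∀ M ∈ hodgeGroup Ψ₂, ∀ N ∈ hodgeGroup Ψ₂, M * N = N * M
  · exact hT.forall_divisorClasses_powPeriod_prod_eq_hodgeClasses_of_isTotallyReal_centerField_of_commutator_eq_bot hη₁
      (commutator_hodgeGroupC_eq_bot_of_hodgeGroup_comm hc₂) hSNT hSNS
  by_cases hE₂ : endAlgRat Ψ₂ = ⊥
  · -- `S` Hodge-general, `dim Hg(T) = 9 < 10`
    have h9 : finrank ℝ (hodgeGroupLie Ψ₁) < 10 := by
      rcases hT.finrank_hodgeGroupLie_eq_three_or_eq_nine_or_eq_of_finrank_eq_three hη₁ h3 with h | h | h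
      · omega
      · omega
      · exact absurd ((hη₁.finrank_hodgeGroupLie_eq_iff_endAlgRat_eq_bot_of_finrank_eq_three h3).1 h) hE₁
    have hlt : (isZConnected_map_toGL_hodgeGroupC Ψ₁).zdim < finrank ℂ E₂ * (2 * finrank ℂ E₂ + 1) := by
      rw [← finrank_hodgeGroupLie_eq_zdim Ψ₁, h2]
      omega
    exact (isIsomorphic_prodPeriod_comm Ψ₁ Ψ₂).isIsogenous.forall_powPeriod_divisorClasses_eq_hodgeClasses_iff.2
      (hAS.forall_divisorClasses_powPeriod_prod_eq_hodgeClasses_of_endAlgRat_eq_bot_of_zdim_lt Ψ₁ hE₂ hSNS hlt hSNT)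
  · exact hT.forall_divisorClasses_powPeriod_prod_eq_hodgeClasses_of_isTotallyReal_of_not_hodgeGroup_comm_of_finrank_eq_three_two
      hS hη₁ hη₂ h3 h2 hE₁ hc₂ hE₂

omit [Nonempty κ₁] in
/-- **ANY SIMPLE THREEFOLD `T` AND A SURFACE `S` WITH `End⁰(S) = ℚ`: `T × S` satisfies (D)** — `End⁰(T) = ℚ`: `T` is
Hodge-general; otherwise `dim Hg(T) ∈ {3, 9} < 10 = dim Sp₄` and the Hodge-general `S` splits off `T` ((5.6), (5.9) with (3.1)).
[cite: MoonenZarhin1999LowDim, §5 (5.6) (p0009 L122–L130), (5.9) (p0010 L13–L15), §3 (3.1) and Thm. (0.2) (4)] [cite: Gordon1999HodgeAVSurvey, Thm. 7.5 and 7.6.2] -/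
theorem IsSimple.forall_divisorClasses_powPeriod_prod_eq_hodgeClasses_of_endAlgRat_eq_bot_of_finrank_eq_three_two
    (hT : IsSimple Ψ₁) (hη₁ : IsRiemannForm Ψ₁ η₁) (hη₂ : IsRiemannForm Ψ₂ η₂) (h3 : finrank ℂ E₁ = 3) (h2 : finrank ℂ E₂ = 2)
    (hE₂ : endAlgRat Ψ₂ = ⊥) :
    ∀ k p, divisorClasses (powPeriod (prodPeriod Ψ₁ Ψ₂) k) p = hodgeClasses (powPeriod (prodPeriod Ψ₁ Ψ₂) k) p := by
  haveI : Nonempty κ₁ := nonempty_of_finrank_pos₅₇ Ψ₁ (by omega)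
  have hAT : IsAbelianVariety Ψ₁ := ⟨η₁, hη₁⟩
  have hAS : IsAbelianVariety Ψ₂ := ⟨η₂, hη₂⟩
  have hSNT := hη₁.forall_divisorClasses_powPeriod_eq_hodgeClasses_of_finrank_eq_three h3
  have hSNS := hAS.forall_divisorClasses_powPeriod_eq_hodgeClasses_of_finrank_eq_two h2
  by_cases hE₁ : endAlgRat Ψ₁ = ⊥
  · exact hAT.forall_divisorClasses_powPeriod_prod_eq_hodgeClasses_of_finrank_eq_three_of_endAlgRat_eq_bot_of_finrank_eq_two
      Ψ₂ h3 hE₁ hAS h2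
  have h9 : finrank ℝ (hodgeGroupLie Ψ₁) < 10 := by
    rcases hT.finrank_hodgeGroupLie_eq_three_or_eq_nine_or_eq_of_finrank_eq_three hη₁ h3 with h | h | h
    · omega
    · omega
    · exact absurd ((hη₁.finrank_hodgeGroupLie_eq_iff_endAlgRat_eq_bot_of_finrank_eq_three h3).1 h) hE₁
  have hlt : (isZConnected_map_toGL_hodgeGroupC Ψ₁).zdim < finrank ℂ E₂ * (2 * finrank ℂ E₂ + 1) := by
    rw [← finrank_hodgeGroupLie_eq_zdim Ψ₁, h2]
    omega
  exact (isIsomorphic_prodPeriod_comm Ψ₁ Ψ₂).isIsogenous.forall_powPeriod_divisorClasses_eq_hodgeClasses_iff.2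
    (hAS.forall_divisorClasses_powPeriod_prod_eq_hodgeClasses_of_endAlgRat_eq_bot_of_zdim_lt Ψ₁ hE₂ hSNS hlt hSNT)

omit [Nonempty κ₁] in
/-- **(5.7) ∕ (5.8) FOR `T` OF CM TYPE AND `S` A SIMPLE SURFACE NOT OF CM TYPE: `T × S` satisfies (D)** — `Hg(T)` commutative,
`Hg(S)` non-commutative hence perfect (types I(1), I(2), II(1)): perfect × commutative splits (Thm. (3.3)(2) with the roles
`X₁ = S` «no factors of Type 4», `X₂ = T` «of CM-type»). [cite: MoonenZarhin1999LowDim, §3 Thm. (3.3)(2) (p0006 L76–L78), §5 (5.7)–(5.8) (p0009 L132 – p0010 L11) and Thm. (0.2) (4)]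
[cite: Gordon1997, §3 Theorem, proof] -/
theorem IsSimple.forall_divisorClasses_powPeriod_prod_eq_hodgeClasses_of_hodgeGroup_comm_of_not_hodgeGroup_comm_of_finrank_eq_three_two
    (hS : IsSimple Ψ₂) (hη₁ : IsRiemannForm Ψ₁ η₁) (hη₂ : IsRiemannForm Ψ₂ η₂) (h3 : finrank ℂ E₁ = 3) (h2 : finrank ℂ E₂ = 2)
    (hc₁ : ∀ M ∈ hodgeGroup Ψ₁, ∀ N ∈ hodgeGroup Ψ₁, M * N = N * M)
    (hnc₂ : ¬ ∀ M ∈ hodgeGroup Ψ₂, ∀ N ∈ hodgeGroup Ψ₂, M * N = N * M) :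
    ∀ k p, divisorClasses (powPeriod (prodPeriod Ψ₁ Ψ₂) k) p = hodgeClasses (powPeriod (prodPeriod Ψ₁ Ψ₂) k) p :=
  forall_divisorClasses_powPeriod_prod_eq_hodgeClasses_of_hodgeGroupC_prod_eq
    (hS.hodgeGroupC_prod_eq_blockDiagProd_of_hodgeGroup_comm_of_not_hodgeGroup_comm_of_finrank_eq_two hc₁ hη₂ h2 hnc₂)
    (hη₁.forall_divisorClasses_powPeriod_eq_hodgeClasses_of_finrank_eq_three h3)
    (IsAbelianVariety.forall_divisorClasses_powPeriod_eq_hodgeClasses_of_finrank_eq_two ⟨η₂, hη₂⟩ h2)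

/-! ## §3 The dispatch: `T × S` satisfies (D) unless `T` is of type IV and (`S` has `End⁰ ≠ ℚ` and (`T` is not CM or `S` is CM)) -/

/-- **MOONEN–ZARHIN THM. (0.2) (4) FOR `X = T × S`, `T` A SIMPLE THREEFOLD, `S` A SIMPLE SURFACE — THE COVERED CLASSES IN ONE
STATEMENT: `ℬ•(Xⁿ) = 𝒟•(Xⁿ)` for all `n`** whenever (hypothesis `h`): if the centre of `End⁰(T)` is a CM field (types IV(1,1),
IV(3,1)), then `End⁰(S) = ℚ`, or `T` is of CM type (`Hg(T)` commutative) and `S` is not (`Hg(S)` non-commutative).  So: every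
`T` of type I against every simple `S` ((5.6)–(5.7) with Thm. (3.3)); every `T` against `S` with `End⁰(S) = ℚ`; `T` CM against
`S` of types I(1), I(2), II(1) ((5.7)–(5.8)).  Not covered (-- TODO(general form)): `T` of type IV(1,1) × `S` ∈ {I(2), II(1),
IV} ((5.8) Lemma (3.5), (5.10) Lemma (3.6)), `T` CM × `S` CM ((5.10), Galois groups).
[cite: MoonenZarhin1999LowDim, Thm. (0.2) (4) (p0002 L1–L8), §5 (5.6)–(5.10) (p0009 L122 – p0010 L45), §3 Thm. (3.3), (3.1)]
[cite: Gordon1999HodgeAVSurvey, Thm. 7.5 and 7.6.2] -/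
theorem IsSimple.forall_divisorClasses_powPeriod_prod_eq_hodgeClasses_of_finrank_eq_three_two (hT : IsSimple Ψ₁)
    (hS : IsSimple Ψ₂) (hη₁ : IsRiemannForm Ψ₁ η₁) (hη₂ : IsRiemannForm Ψ₂ η₂) (h3 : finrank ℂ E₁ = 3) (h2 : finrank ℂ E₂ = 2)
    (h : IsCMField (centerField Ψ₁ hT) → endAlgRat Ψ₂ = ⊥ ∨
      ((∀ M ∈ hodgeGroup Ψ₁, ∀ N ∈ hodgeGroup Ψ₁, M * N = N * M) ∧ ¬ ∀ M ∈ hodgeGroup Ψ₂, ∀ N ∈ hodgeGroup Ψ₂, M * N = N * M)) :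
    ∀ k p, divisorClasses (powPeriod (prodPeriod Ψ₁ Ψ₂) k) p = hodgeClasses (powPeriod (prodPeriod Ψ₁ Ψ₂) k) p := by
  rcases hT.centerField_isTotallyReal_or_isCMField hη₁ with hR | hCM
  · haveI := hR
    exact hT.forall_divisorClasses_powPeriod_prod_eq_hodgeClasses_of_isTotallyReal_of_finrank_eq_three_two hS hη₁ hη₂ h3 h2
  · rcases h hCM with hE₂ | ⟨hc₁, hnc₂⟩
    · exact hT.forall_divisorClasses_powPeriod_prod_eq_hodgeClasses_of_endAlgRat_eq_bot_of_finrank_eq_three_two hη₁ hη₂ h3 h2 hE₂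
    · exact hS.forall_divisorClasses_powPeriod_prod_eq_hodgeClasses_of_hodgeGroup_comm_of_not_hodgeGroup_comm_of_finrank_eq_three_two
        hη₁ hη₂ h3 h2 hc₁ hnc₂

end ThreefoldTimesSurface

section ThreefoldTimesSurfaceIsogenous

variable {ι : Type*} [Fintype ι] [DecidableEq ι] {F : Type*} [NormedAddCommGroup F] [NormedSpace ℂ F]
  {Φ : (ι → ℝ) ≃L[ℝ] F}
  {κ₁ κ₂ : Type} [Fintype κ₁] [DecidableEq κ₁] [Nonempty κ₁] [Fintype κ₂] [DecidableEq κ₂] [Nonempty κ₂]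
  {E₁ E₂ : Type} [NormedAddCommGroup E₁] [NormedSpace ℂ E₁] [FiniteDimensional ℂ E₁] [NormedAddCommGroup E₂]
  [NormedSpace ℂ E₂] [FiniteDimensional ℂ E₂] {Ψ₁ : (κ₁ → ℝ) ≃L[ℝ] E₁} {Ψ₂ : (κ₂ → ℝ) ≃L[ℝ] E₂}
  {η₁ : E₁ [⋀^Fin 2]→L[ℝ] ℝ} {η₂ : E₂ [⋀^Fin 2]→L[ℝ] ℝ}

/-- **Every complex torus ISOGENOUS to `T × S` in the covered classes satisfies condition (D).**
[cite: MoonenZarhin1999LowDim, Thm. (0.2) (4) (p0002 L1–L8) and §5 (5.6)–(5.10)] [cite: Lange2023AbelianVarietiesComplex, §1.1.2 Cor. 1.1.16] -/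
theorem IsIsogenous.forall_divisorClasses_powPeriod_eq_hodgeClasses_of_prod_of_finrank_eq_three_two
    (hiso : IsIsogenous Φ (prodPeriod Ψ₁ Ψ₂)) (hT : IsSimple Ψ₁) (hS : IsSimple Ψ₂) (hη₁ : IsRiemannForm Ψ₁ η₁)
    (hη₂ : IsRiemannForm Ψ₂ η₂) (h3 : finrank ℂ E₁ = 3) (h2 : finrank ℂ E₂ = 2)
    (h : IsCMField (centerField Ψ₁ hT) → endAlgRat Ψ₂ = ⊥ ∨
      ((∀ M ∈ hodgeGroup Ψ₁, ∀ N ∈ hodgeGroup Ψ₁, M * N = N * M) ∧ ¬ ∀ M ∈ hodgeGroup Ψ₂, ∀ N ∈ hodgeGroup Ψ₂, M * N = N * M)) :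
    ∀ k p, divisorClasses (powPeriod Φ k) p = hodgeClasses (powPeriod Φ k) p :=
  hiso.forall_powPeriod_divisorClasses_eq_hodgeClasses_iff.2
    (hT.forall_divisorClasses_powPeriod_prod_eq_hodgeClasses_of_finrank_eq_three_two hS hη₁ hη₂ h3 h2 h)

/-- **«`Hg(X) = Sp_D(V,φ)`» FOR `X ∼ T × S` IN THE COVERED CLASSES** (real points, any polarisation `ω` of `X`), from (D) by
Gordon's Thm. 7.5 (1) ⟹ (2). [cite: MoonenZarhin1999LowDim, Thm. (0.2) (4) (p0002 L5–L8)] [cite: Gordon1999HodgeAVSurvey, Thm. 7.5 (1) ⟺ (2)]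
[cite: Milne1999LefschetzClasses, §4 Prop. 4.8] -/
theorem IsRiemannForm.hodgeGroup_eq_lefschetzGroup_of_isIsogenous_prod_of_finrank_eq_three_two {ι' : Type} [Fintype ι']
    [DecidableEq ι'] {F' : Type} [NormedAddCommGroup F'] [NormedSpace ℂ F'] [FiniteDimensional ℂ F']
    {Φ' : (ι' → ℝ) ≃L[ℝ] F'} {ω : F' [⋀^Fin 2]→L[ℝ] ℝ} (hω : IsRiemannForm Φ' ω) (hiso : IsIsogenous Φ' (prodPeriod Ψ₁ Ψ₂))
    (hT : IsSimple Ψ₁) (hS : IsSimple Ψ₂) (hη₁ : IsRiemannForm Ψ₁ η₁) (hη₂ : IsRiemannForm Ψ₂ η₂) (h3 : finrank ℂ E₁ = 3)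
    (h2 : finrank ℂ E₂ = 2)
    (h : IsCMField (centerField Ψ₁ hT) → endAlgRat Ψ₂ = ⊥ ∨
      ((∀ M ∈ hodgeGroup Ψ₁, ∀ N ∈ hodgeGroup Ψ₁, M * N = N * M) ∧ ¬ ∀ M ∈ hodgeGroup Ψ₂, ∀ N ∈ hodgeGroup Ψ₂, M * N = N * M)) :
    hodgeGroup Φ' = lefschetzGroup Φ' ω := by
  obtain ⟨G, hG⟩ := hω.exists_ratMatrix_latticeGram
  have h0 : 0 < finrank ℂ F' := by
    have hc := hiso.card_eq
    rw [Fintype.card_sum, card_eq_two_mul_finrank Φ', card_eq_two_mul_finrank Ψ₁, h3] at hc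
    omega
  exact ((hω.forall_divisorClasses_powPeriod_eq_hodgeClasses_iff_eq_and_hodgeGroup_eq_lefschetzGroup hG h0).1
    (hiso.forall_divisorClasses_powPeriod_eq_hodgeClasses_of_prod_of_finrank_eq_three_two hT hS hη₁ hη₂ h3 h2 h)).2

end ThreefoldTimesSurfaceIsogenous

end ComplexTorus

end Literature.Geometry.Kaehler
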